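import Mathlib
import Literature.MathematicalPhysics.QuantumFieldTheory.Balaban1983to89.B6Decomp247Surfaces

/-!
# `Balaban1983to89.B6Decomp247LevelGap` — [Balaban1984PropagatorsII] pp. 231–234: THE PRINTED ROUTE from the
# decomposition (2.47) through (2.57) to the exponent of (2.60) — every crossing portion Γ_{y′_l,y_{l+1}} between two
# consecutive surfaces has at least RM admissible bonds, the number m of surface episodes is at least |j − j′|, hence
# RM·max{|j − j′| − 1, 0} ≤ d(y, y′) — KERNEL-DERIVED on the decomposition of `…B6Decomp247Surfaces` from the walk form of
# condition (2.2) (`B6Geometry.LevelGap`)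

statement-level skeleton of published theorems with citation tags; proofs where landed; nothing here is a claim about the Yang–Mills mass gap

CITATION HEADER (lean-in-tree rule 2026-08-18).  Source: T. Bałaban, *Propagators and renormalization transformations for
lattice gauge theories. II*, Commun. Math. Phys. **96**, 223–250 (1984), doi:10.1007/bf01240221 [Balaban1984PropagatorsII]
(cell paper B6; held `paper:balaban1984-cmp96-propagators-rt-ii`, journal page = PDF page + 222; pp. 231–234 [PDF 9–12]
read AS IMAGES on the ×2 renders `…/1984-cmp96-propagators-rt-II-p009…p012-x2.png`, 2026-08-21).  lit-balaban SKELETON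
rows **B6.Eq2.47** ((2.47)–(2.48)), **B6.Eq2.56** ((2.57)), **B6.Lem2.1** ((2.60)); unit `lit-balaban-r03` (gen 7), HOME
`run/shared/lean/pub/lit-balaban/`.  IMPORTS, NOT MODIFIED: `…B6Decomp247Surfaces` (same unit, p266990: the decomposition
(2.47) of every admissible contour at the crossing points `OnSurf` — `aIdx`/`bIdx`/`eIdx`/`js`/`m`, `onSurf_aIdx`/
`onSurf_bIdx`, `js_step`, `js_one_bounds`, `js_m_bounds`, `getVert_eIdx`, …), through it `…B6Geometry` (pv08: `Separates`,
`LevelGap` = the walk form of (2.2)/(2.57), and the height-function theorem `levelGap_dist`, whose conclusion §4 re-derives by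
the printed route).  Nothing is restated.

THE PRINTED TEXT (verbatim).  p. 233 [11]: *"From the condition (2.2) and from the definition of the points y′_l,
y_{l+1}, more exactly from the fact that they belong to different surfaces Σ_j, we have (L^{j_{l,l+1}}η)^{−1}|y′_l −
y_{l+1}| > RM. (2.57) The distances on the right-hand side of (2.48) are scaled to unit lattice and we estimate
e^{−αδ₀d(y,y′)} using (2.48) and adding sums over all intermediate points y_l, y′_l, l = 1, …, m, and over all possible
numbers m. We get Σ_{y′∈𝔅} e^{−αδ₀d(y,y′)} = … Σ_{j′=0}^{k} Σ_{m=max{|j−j′|−1,0}}^{∞} e^{−½αδ₀mRM}(c₀(½α))^{d(2m+1)} (2.58)"*.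
p. 234 [12], Lemma 2.1: *"e^{−αδ₀d(y,y′)} ≤ e^{−αδ₀RM max{|j−j′|−1,0}}, y ∈ Λ_j, y′ ∈ Λ_{j′}, (2.60)"*; its proof:
*"The inequality (2.60) follows from (2.57)."*

THE DICTIONARY (that of `B6Geometry`, D-pv08g2.1).  Condition (2.2) enters in its WALK FORM `LevelGap G zone N`, N = RM
(every chain of admissible bonds from a point of zone < i to a point of zone > i has more than N bonds; derived from the
metric (2.2) in `…B6LevelGapMetric`); the scaled length (L^jη)^{−1}|Γ_portion| of a portion of Λ_j-bonds is its NUMBER of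
bonds; the surfaces are the crossing points `OnSurf` and y_l, y′_l, j_l, m are those of `…B6Decomp247Surfaces`.

WHAT IS PROVED (kernel-checked; no `sorry`; standard axioms; 0 new `def … : Prop` facts).  §1 `portion p s t` (Γ_{v_s,v_t}
as a walk, `Walk.drop`/`Walk.take`), `portion_length` (= t − s).  §2 **`crossing_length_ge`** — (2.57) IN WALK-COUNT FORM,
PER PORTION: for 1 ≤ l < m the crossing portion Γ_{y′_l,y_{l+1}} (inside B^{j_{l,l+1}}(Λ_{j_{l,l+1}}), from Σ_{j_l} to
Σ_{j_{l+1}}, |j_l − j_{l+1}| = 1) has at least N bonds (prepend the Λ_{j_l−1}-bond at y′_l when j_{l+1} = j_l + 1, resp.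
append the Λ_{j_{l+1}−1}-bond at y_{l+1} and reverse when j_{l+1} = j_l − 1, and apply `LevelGap` across the full zone);
**`length_ge_mul_episodes`**: N·(m − 1) ≤ |Γ|_bonds for every admissible contour (the separation datum `hsep` of the
cell's hypothesis structure `B6Lemma21Bridge.Decomp247`, here a theorem about the printed decomposition).  §3 `js_bounds`
(j_l ≤ j + l, j ≤ j_l + l − 1), **`zone_diff_le_m`**: |j − j′| ≤ m (a contour from Λ_j to Λ_{j′} has at least |j − j′|
surface episodes; cf. the lower summation index m ≥ max{|j − j′| − 1, 0} of (2.58)).  §4 **`length_ge_levels`**: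
N·(|j − j′| − 1) ≤ |Γ|_bonds for every admissible contour (both orderings, truncated subtraction), **`levelGap_dist_via247`**:
the same for the distance (2.46) given that contours exist — the exponent inequality behind (2.60) BY THE PRINTED ROUTE
(2.47) + (2.57); `levelGap_dist_via247_eq_tree`: for N ≥ 1 this is the conclusion of the tree's `B6Geometry.levelGap_dist`
(height-function route), now without its ordering hypothesis.

TYPING ∕ DIVERGENCE.  (a) (2.57) is proved in the walk-count form the dictionary gives it ((L^{j_{l,l+1}}η)^{−1}
|Γ_{y′_l,y_{l+1}}| ≥ RM as "≥ N bonds"), which is what (2.58)/(2.60) consume; the STRAIGHT-LINE form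
(L^{j_{l,l+1}}η)^{−1}|y′_l − y_{l+1}| > RM of the display needs the metric (2.2) read with the surface Σ_{j} counted on the
Ω_j^c side (print: dist(Ω_j^c, Ω_{j+1}) with Σ_j ⊂ closure of Ω_j^c); from the tree's lattice-point form `Cond22`/`ZoneSep`
(points of zone < j versus points of zone > j) one only gets > RM − 1/L for the straight distance, through the
Λ_{j−1}-bond at y′_l — NOT derived here (row B6.Eq2.56 records the located defects of (2.58) and its repairs).  (b) The
count inequality holds for every admissible contour, not only the minimising one; for the first and last portions
Γ_{y,y₁}, Γ_{y′_m,y′} no lower bound holds (y may sit next to Σ_{j+1}), exactly as in print where only the m − 1 (resp.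
m) middle legs carry the factor e^{−½αδ₀RM}.  (c) |j − j′| ≤ m is the sharp count (print's summation starts one lower, at
|j − j′| − 1, which is weaker and also correct).

HONEST SCOPE.  Walk combinatorics on the decomposition of the sibling; no metric geometry, no (2.58), no Lemma 2.1
constant, NOT progress on any Clay problem.
-/

namespace Literature.MathematicalPhysics.QuantumFieldTheory.Balaban1983to89.B6Decomp247LevelGap

open Literature.MathematicalPhysics.QuantumFieldTheory.Balaban1983to89
open B6Geometry Finset
open Literature.MathematicalPhysics.QuantumFieldTheory.Balaban1983to89.B6Decomp247Surfaces

variable {V : Type*} {G : SimpleGraph V} {zone : V → ℕ} {x x' : V}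

/-! ## 1. Portions of a contour as walks -/

/-- The portion Γ_{v_s,v_t} (s ≤ t) of a contour as an admissible contour in its own right. [cite: Balaban1984PropagatorsII, (2.47) p.231] -/
def portion (p : G.Walk x x') (s t : ℕ) (hst : s ≤ t) : G.Walk (p.getVert s) (p.getVert t) :=
  ((p.drop s).take (t - s)).copy rfl (by rw [SimpleGraph.Walk.drop_getVert, Nat.add_sub_cancel' hst])

/-- The portion Γ_{v_s,v_t} has t − s bonds (t ≤ |Γ|). [cite: Balaban1984PropagatorsII, (2.47) p.231] -/
theorem portion_length (p : G.Walk x x') {s t : ℕ} (hst : s ≤ t) (htn : t ≤ p.length) :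
    (portion p s t hst).length = t - s := by
  unfold portion
  rw [SimpleGraph.Walk.length_copy, SimpleGraph.Walk.take_length, SimpleGraph.Walk.drop_length]
  omega

/-! ## 2. (2.57) in walk form: a crossing portion between two consecutive surfaces has at least RM bonds -/

/-- **(2.57), WALK-COUNT FORM, PER CROSSING PORTION** (p. 233 [11]: *"From the condition (2.2) and from the definition of
the points y′_l, y_{l+1}, more exactly from the fact that they belong to different surfaces Σ_j, we have
(L^{j_{l,l+1}}η)^{−1}|y′_l − y_{l+1}| > RM. (2.57)"*; in the `B6Geometry` dictionary the scaled length of a portion of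
Λ_{j}-bonds is its number of bonds and (2.2) is the walk condition `LevelGap N`, N = RM): for 1 ≤ l < m the crossing
portion Γ_{y′_l,y_{l+1}} of the decomposition (2.47) of ANY admissible contour, which runs inside B^{j_{l,l+1}}(Λ_{j_{l,l+1}})
from Σ_{j_l} to Σ_{j_{l+1}}, |j_l − j_{l+1}| = 1, has at least N bonds — prepend the bond from B^{j_l−1} through which y′_l
is a surface point (resp. append the one at y_{l+1}) and apply `LevelGap` across the full zone. [cite: Balaban1984PropagatorsII, (2.57) p.233] -/
theorem crossing_length_ge (hsep : Separates G zone) {N : ℕ} (hgap : LevelGap G zone N) (p : G.Walk x x')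
    {l : ℕ} (hl1 : 1 ≤ l) (hl : l + 1 ≤ m zone p) :
    N ≤ eIdx zone p (l + 1) - bIdx zone p l := by
  have hlm : l ≤ m zone p := by omega
  have hst : bIdx zone p l ≤ eIdx zone p (l + 1) := bIdx_le_eIdx_succ p hlm
  have htn : eIdx zone p (l + 1) ≤ p.length := eIdx_le_length p (l + 1)
  have hlen := portion_length p hst htn
  have hzs : zone (p.getVert (bIdx zone p l)) = js zone p l := zone_getVert_bIdx p hlm
  have hzt : zone (p.getVert (eIdx zone p (l + 1))) = js zone p (l + 1) := zone_getVert_eIdx p (l + 1)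
  rcases js_step hsep p hl1 hl with hdown | hup
  · -- j_{l+1} = j_l − 1: y_{l+1} ∈ Σ_{j_{l+1}} has a bond from zone j_{l+1} − 1; walk back to y′_l (zone j_l)
    have hsurf : OnSurf G zone (js zone p (l + 1)) (p.getVert (eIdx zone p (l + 1))) := by
      rw [getVert_eIdx]; exact onSurf_aIdx p (by omega) hl
    obtain ⟨-, u, hu, hzu⟩ := hsurf
    have q : G.Walk u (p.getVert (bIdx zone p l)) := SimpleGraph.Walk.cons hu (portion p _ _ hst).reverse
    have hq := hgap (i := js zone p (l + 1)) (u := u) (x := p.getVert (bIdx zone p l)) (by omega) (by omega)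
      (SimpleGraph.Walk.cons hu (portion p _ _ hst).reverse)
    rw [SimpleGraph.Walk.length_cons, SimpleGraph.Walk.length_reverse, hlen] at hq
    omega
  · -- j_{l+1} = j_l + 1: y′_l ∈ Σ_{j_l} has a bond from zone j_l − 1; walk on to y_{l+1} (zone j_l + 1)
    obtain ⟨-, u, hu, hzu⟩ := onSurf_bIdx p hl1 hlm
    have hq := hgap (i := js zone p l) (u := u) (x := p.getVert (eIdx zone p (l + 1))) (by omega) (by omega)
      (SimpleGraph.Walk.cons hu (portion p _ _ hst))
    rw [SimpleGraph.Walk.length_cons, hlen] at hq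
    omega

/-- Hence the m − 1 middle crossing portions alone give **RM·(m − 1) ≤ |Γ|_bonds** for every admissible contour (the
separation datum `hsep` of `B6Lemma21Bridge.Decomp247`: RM(m − 1) ≤ d(y, y′)). [cite: Balaban1984PropagatorsII, (2.57) p.233] -/
theorem length_ge_mul_episodes (hsep : Separates G zone) {N : ℕ} (hgap : LevelGap G zone N) (p : G.Walk x x') :
    N * (m zone p - 1) ≤ p.length := by
  -- sum the disjoint index intervals [b_l, e_{l+1}], l = 1, …, m − 1, inside [e_1, e_m] ⊆ [0, |Γ|]
  have key : ∀ k, k + 1 ≤ m zone p → N * k + eIdx zone p 1 ≤ eIdx zone p (k + 1) := by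
    intro k hk
    induction k with
    | zero => simp
    | succ k ih =>
      have h1 := ih (by omega)
      have h2 := crossing_length_ge hsep hgap p (l := k + 1) (by omega) (by omega)
      have h3 := eIdx_le_bIdx (zone := zone) p (l := k + 1) (by omega) (by omega)
      have h4 := bIdx_le_eIdx_succ (zone := zone) p (l := k + 1) (by omega)
      have : N * (k + 1) = N * k + N := by ring
      omega
  rcases Nat.eq_zero_or_pos (m zone p) with h0 | hpos
  · rw [h0]; simp
  · have h := key (m zone p - 1) (by omega)
    have h' := eIdx_le_length (zone := zone) p (m zone p - 1 + 1)
    omega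

/-! ## 3. The number of episodes bounds the level difference: |j − j′| ≤ m -/

/-- Along the surfaces of (2.47): j_l ≤ j + l and j ≤ j_l + (l − 1) for 1 ≤ l ≤ m (j₁ ∈ {j, j+1}, |j_l − j_{l+1}| = 1).
[cite: Balaban1984PropagatorsII, (2.47) p.231] -/
theorem js_bounds (hsep : Separates G zone) (p : G.Walk x x') {l : ℕ} (hl1 : 1 ≤ l) (hl : l ≤ m zone p) :
    js zone p l ≤ zone x + l ∧ zone x ≤ js zone p l + (l - 1) := by
  induction l with
  | zero => omega
  | succ l ih =>
    rcases Nat.eq_zero_or_pos l with rfl | hlpos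
    · have h := js_one_bounds hsep p
      simp only [zero_add]
      omega
    · have h := ih hlpos (by omega)
      have hs := js_step hsep p (l := l) hlpos hl
      omega

/-- **|j − j′| ≤ m**: a contour from Λ_j to Λ_{j′} meets at least |j − j′| surfaces in the sense of (2.47) (so the
summation in (2.58) starts at m = max{|j − j′| − 1, 0} at the latest). [cite: Balaban1984PropagatorsII, (2.47) p.231 + (2.58) p.233] -/
theorem zone_diff_le_m (hsep : Separates G zone) (p : G.Walk x x') :
    zone x ≤ zone x' + m zone p ∧ zone x' ≤ zone x + m zone p := by
  have hend := js_m_bounds hsep p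
  rcases Nat.eq_zero_or_pos (m zone p) with h0 | hpos
  · have h1 := js_one_bounds hsep p
    have : js zone p 1 = zone x' := by rw [← js_m_succ (zone := zone) p, h0]
    rw [h0] at hend ⊢
    rw [js_zero] at hend
    omega
  · have h := (js_bounds hsep p (l := m zone p) hpos le_rfl).1
    have h' := (js_bounds hsep p (l := m zone p) hpos le_rfl).2
    omega

/-! ## 4. (2.60)'s exponent by the printed route: RM·max{|j − j′| − 1, 0} ≤ d(y, y′) from (2.47) + (2.57) -/

/-- **The printed route to (2.60)** (p. 234 [12]: *"e^{−αδ₀d(y,y′)} ≤ e^{−αδ₀RM max{|j−j′|−1,0}}"* obtained in print from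
the decomposition (2.47)–(2.48) and (2.57)): for EVERY admissible contour from a point of zone j to a point of zone j′,
N·(|j − j′| − 1) ≤ |Γ|_bonds (walk condition `LevelGap N` for (2.2), `Separates` for p. 231) — by `length_ge_mul_episodes`
and `zone_diff_le_m`. (The tree's `B6Geometry.levelGap_dist` proves the same bound for the distance by a height-function
argument; this is the print's own route.) [cite: Balaban1984PropagatorsII, (2.60) p.234 + (2.47) p.231 + (2.57) p.233] -/
theorem length_ge_levels (hsep : Separates G zone) {N : ℕ} (hgap : LevelGap G zone N) (p : G.Walk x x') :
    N * (zone x' - zone x - 1) ≤ p.length ∧ N * (zone x - zone x' - 1) ≤ p.length := by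
  have h1 := length_ge_mul_episodes hsep hgap p
  have h2 := zone_diff_le_m hsep p
  constructor
  · calc N * (zone x' - zone x - 1) ≤ N * (m zone p - 1) := Nat.mul_le_mul_left _ (by omega)
      _ ≤ p.length := h1
  · calc N * (zone x - zone x' - 1) ≤ N * (m zone p - 1) := Nat.mul_le_mul_left _ (by omega)
      _ ≤ p.length := h1

/-- **(2.60)'s exponent for the distance (2.46)**, printed route: N·(j′ − j − 1) ≤ d(x, x′) for zone x < zone x′ — the
statement of `B6Geometry.levelGap_dist`, re-derived through (2.47) + (2.57) (given that contours exist).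
[cite: Balaban1984PropagatorsII, (2.60) p.234] -/
theorem levelGap_dist_via247 (hsep : Separates G zone) {N : ℕ} (hgap : LevelGap G zone N) (hxx : G.Reachable x x') :
    N * (zone x' - zone x - 1) ≤ G.dist x x' ∧ N * (zone x - zone x' - 1) ≤ G.dist x x' := by
  obtain ⟨p, hp⟩ := hxx.exists_walk_length_eq_dist
  rw [← hp]
  exact length_ge_levels hsep hgap p

/-- Consistency with the tree's height-function route: for N ≥ 1 (`Separates` then follows from `LevelGap`,
`B6Geometry.separates_of_levelGap`) the printed route gives the conclusion of `B6Geometry.levelGap_dist` (there stated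
under zone x < zone x′) with no hypothesis beyond connectedness. [cite: Balaban1984PropagatorsII, (2.60) p.234] -/
theorem levelGap_dist_via247_eq_tree (hconn : G.Connected) {N : ℕ} (hgap : LevelGap G zone N) (hN : N ≠ 0) :
    N * (zone x' - zone x - 1) ≤ G.dist x x' :=
  (levelGap_dist_via247 (separates_of_levelGap hgap hN) hgap (hconn x x')).1

end Literature.MathematicalPhysics.QuantumFieldTheory.Balaban1983to89.B6Decomp247LevelGap
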